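import Summits.HodgeConjecture.CorCM.IrreducibleOddWeightsIsotypicFrobeniusBounds
import HarnessLib

/-!
# Isotypic cells, Frobenius VII: HOM-SPACES ARE ADDITIVE OVER THE ISOTYPIC SUMMANDS OF THE TARGET AND DO NOT SEE
# WHICH COPY OF A REFERENCE THEY MAP TO — `dim Hom_G(ℚ^{Y₁}, ℚ^{Y₂}) = Σ_q dim Hom_G(ℚ^{Y₁}, N_q)`,
# `dim Hom_G(ℚ^{Y₁}, θ′(A)) = dim Hom_G(ℚ^{Y₁}, A)`

COR-CM (cell `pub-hodgecm2`, binder seat `b16` gen 77, count-neutral claim FROBENIUS RECIPROCITY IN THE REFERENCE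
CURRENCY — MULTIPLICITIES FROM FIXED POINTS, file R7 — the Hom-space calculus for the intertwining count of file
R8 `CorCM/IrreducibleOddWeightsIsotypicFrobeniusIntertwining`; theorems only, no definition, no named fact, no
`sorry`).  NEW as stated, hence under `Summits/`.  HONEST FRAMING: finite-dimensional linear algebra in the
Hom-space currency of file R1 (`𝓗 = Hom_G(ℚ^{Y₁}, A)` carried as a parameter subspace of `Hom_ℚ(ℚ^{Y₁}, ℚ^Y)`
with its characterising hypothesis); nothing about Hodge classes is asserted, `HC_CM` is neither used nor asserted.

* §1 `finrank_pi_eq_sum` (`dim ∏_q p_q = Σ_q dim p_q` for a finite family of subspaces),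
  `exists_equivariant_proj_of_iSupIndep` (for an INDEPENDENT family of STABLE subspaces `N_q ≤ ℚ^{Y₂}` spanning
  `ℚ^{Y₂}`, the projection onto `N_q` along the others is an equivariant linear map — file R2's
  `exists_equivariant_proj_summand` for an arbitrary family), `eq_sum_proj` (`v = Σ_q π_q v`).
* §2 **`finrank_homSpace_top_eq_sum`**: `dim Hom_G(ℚ^{Y₁}, ℚ^{Y₂}) = Σ_q dim Hom_G(ℚ^{Y₁}, N_q)` — the map
  `L ↦ (π_q ∘ L)_q` is injective on `Hom_G(ℚ^{Y₁}, ℚ^{Y₂})` with image `∏_q Hom_G(ℚ^{Y₁}, N_q)`.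
* §3 **`finrank_homSpace_map_eq`**: for `θ′ : ℚ^{Y_A} → ℚ^{Y₂}` injective and equivariant on the stable `A`,
  `dim Hom_G(ℚ^{Y₁}, θ′(A)) = dim Hom_G(ℚ^{Y₁}, A)` (`L′ ↦ θ′ ∘ L′`, inverse `L ↦ θ ∘ L` with the equivariant
  inverse `θ` of file R2).

## References

* [Serre1977] J.-P. Serre, *Linear Representations of Finite Groups*, GTM 42, §2.2, §2.6, §7.2.
* [Lang2002] S. Lang, *Algebra*, 3rd ed., XVII §1–§2.
* [CurtisReiner1962] C. W. Curtis, I. Reiner, *Representation Theory of Finite Groups and Associative Algebras*,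
  §27 (27.3).
-/

set_option autoImplicit false

noncomputable section

open scoped BigOperators Classical

universe v v' vA uσ w

namespace Summit.HodgeConjecture.CorCM.IrrOdd

variable {G : Type w} [Group G] {Y₁ : Type v} [MulAction G Y₁] {Y₂ : Type v'} [MulAction G Y₂]

/-! ### §1 Dimension of a product of subspaces; equivariant projections of an independent stable family -/

section Tools

/-- **`dim ∏_q p_q = Σ_q dim p_q`** for a finite family of finite-dimensional subspaces `p_q ≤ M_q`. [folklore] -/
theorem finrank_pi_eq_sum {σ : Type uσ} [Fintype σ] {M : σ → Type v} [∀ q, AddCommGroup (M q)]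
    [∀ q, Module ℚ (M q)] (p : ∀ q, Submodule ℚ (M q)) [∀ q, FiniteDimensional ℚ (p q)] :
    Module.finrank ℚ ↥(Submodule.pi Set.univ p) = ∑ q, Module.finrank ℚ (p q) := by
  let e : (∀ q, ↥(p q)) ≃ₗ[ℚ] ↥(Submodule.pi Set.univ p) :=
    { toFun := fun f => ⟨fun q => (f q : M q), fun q _ => (f q).2⟩
      map_add' := fun f f' => rfl
      map_smul' := fun t f => rfl
      invFun := fun g q => ⟨(g : ∀ q, M q) q, g.2 q trivial⟩
      left_inv := fun f => rfl
      right_inv := fun g => rfl }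
  rw [← e.finrank_eq, Module.finrank_pi_fintype]

omit [MulAction G Y₁] in
/-- **THE PROJECTIONS OF AN INDEPENDENT STABLE SPANNING FAMILY ARE EQUIVARIANT**: for stable subspaces
`N_q ≤ ℚ^{Y₂}` (`q ∈ σ` finite), independent with `⨆_q N_q = ℚ^{Y₂}`, and `q₀ ∈ σ`, there is a linear
`π : ℚ^{Y₂} → ℚ^{Y₂}` with values in `N_{q₀}`, the identity on `N_{q₀}`, zero on every `N_q` (`q ≠ q₀`), commuting
with all translates. [cite: Serre1977, §2.6] [cite: Lang2002, XVII §2] -/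
theorem exists_equivariant_proj_of_iSupIndep {σ : Type uσ} [Fintype σ] {N : σ → Submodule ℚ (Y₂ → ℚ)}
    (hNst : ∀ (q : σ) (k : G) (v : Y₂ → ℚ), v ∈ N q → (fun y => v (k • y)) ∈ N q)
    (hind : iSupIndep N) (htop : (⨆ q, N q) = ⊤) (q₀ : σ) :
    ∃ π : (Y₂ → ℚ) →ₗ[ℚ] (Y₂ → ℚ), (∀ v, π v ∈ N q₀) ∧ (∀ v ∈ N q₀, π v = v) ∧
      (∀ q, q ≠ q₀ → ∀ v ∈ N q, π v = 0) ∧ ∀ (k : G) (v : Y₂ → ℚ), π (fun y => v (k • y)) = fun y => π v (k • y) := by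
  let T : G → (Y₂ → ℚ) →ₗ[ℚ] (Y₂ → ℚ) := fun k => LinearMap.funLeft ℚ ℚ fun y : Y₂ => k • y
  set Q : Submodule ℚ (Y₂ → ℚ) := ⨆ q : {q : σ // q ≠ q₀}, N q.1 with hQ
  have hPst : ∀ (k : G) (v : Y₂ → ℚ), v ∈ N q₀ → T k v ∈ N q₀ := hNst q₀
  have hQst : ∀ (k : G) (v : Y₂ → ℚ), v ∈ Q → T k v ∈ Q := stable_iSup T _ fun q k v hv => hNst q.1 k v hv
  have hQeq : (⨆ (q : σ) (_ : q ≠ q₀), N q) = Q := by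
    refine le_antisymm (iSup₂_le fun q hq => ?_) (iSup_le fun q => ?_)
    · exact le_iSup (fun q : {q : σ // q ≠ q₀} => N q.1) ⟨q, hq⟩
    · exact le_iSup₂ (f := fun (q : σ) (_ : q ≠ q₀) => N q) q.1 q.2
  have hPQ : N q₀ ⊓ Q = ⊥ := by
    have h := hind q₀
    rw [hQeq] at h
    exact disjoint_iff.1 h
  have hPQtop : N q₀ ⊔ Q = ⊤ := by rw [← hQeq, ← iSup_split_single N q₀, htop]
  obtain ⟨π, hπP, hπid, hπQ, -, hπeq⟩ := exists_proj_of_inf_eq_bot T hPst hQst hPQ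
  have hmem : ∀ v : Y₂ → ℚ, v ∈ N q₀ ⊔ Q := fun v => by rw [hPQtop]; exact Submodule.mem_top
  refine ⟨π, hπP, hπid, fun q hq v hv => hπQ v ?_, fun k v => hπeq k v (hmem v)⟩
  rw [← hQeq]
  exact Submodule.mem_iSup_of_mem q (Submodule.mem_iSup_of_mem hq hv)

omit [Group G] [MulAction G Y₁] [MulAction G Y₂] in
/-- **`v = Σ_q π_q v`** for projections `π_q` of an independent spanning family (`π_q` is the identity on `N_q` and
zero on `N_{q′}`, `q′ ≠ q`). [cite: Lang2002, XVII §2] -/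
theorem eq_sum_proj {σ : Type uσ} [Fintype σ] {N : σ → Submodule ℚ (Y₂ → ℚ)} (htop : (⨆ q, N q) = ⊤)
    (π : σ → (Y₂ → ℚ) →ₗ[ℚ] (Y₂ → ℚ)) (hπid : ∀ q, ∀ v ∈ N q, π q v = v)
    (hπkill : ∀ q q', q' ≠ q → ∀ v ∈ N q', π q v = 0) (v : Y₂ → ℚ) : v = ∑ q, π q v := by
  obtain ⟨n, hn, hv⟩ := exists_sum_eq_of_mem_iSup (M := N) (w := v) (by rw [htop]; exact Submodule.mem_top)
  have hπ : ∀ q, π q v = n q := by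
    intro q
    rw [← hv, map_sum, Finset.sum_eq_single q (fun q' _ hq' => hπkill q q' hq' _ (hn q'))
      (fun h => absurd (Finset.mem_univ q) h), hπid q _ (hn q)]
  rw [Finset.sum_congr rfl fun q _ => hπ q, hv]

end Tools

/-! ### §2 Hom-spaces are additive over independent stable summands of the target -/

section Additive

variable [Fintype Y₁] [Fintype Y₂] {σ : Type uσ} [Fintype σ] {N : σ → Submodule ℚ (Y₂ → ℚ)}
  {𝓗t : Submodule ℚ ((Y₁ → ℚ) →ₗ[ℚ] (Y₂ → ℚ))} {𝓗 : σ → Submodule ℚ ((Y₁ → ℚ) →ₗ[ℚ] (Y₂ → ℚ))}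

/-- **`dim Hom_G(ℚ^{Y₁}, ℚ^{Y₂}) = Σ_q dim Hom_G(ℚ^{Y₁}, N_q)`** for an independent family of stable subspaces
`N_q` spanning `ℚ^{Y₂}`: `L ↦ (π_q ∘ L)_q` maps `Hom_G(ℚ^{Y₁}, ℚ^{Y₂})` injectively onto `∏_q Hom_G(ℚ^{Y₁}, N_q)`
(inverse `(L_q)_q ↦ Σ_q L_q`). [cite: Serre1977, §2.6] [cite: Lang2002, XVII §2] -/
theorem finrank_homSpace_top_eq_sum
    (h𝓗t : ∀ L : (Y₁ → ℚ) →ₗ[ℚ] (Y₂ → ℚ), L ∈ 𝓗t ↔ (∀ f, L f ∈ (⊤ : Submodule ℚ (Y₂ → ℚ))) ∧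
      ∀ (k : G) (f : Y₁ → ℚ), L (fun x => f (k • x)) = fun y => L f (k • y))
    (h𝓗 : ∀ (q : σ) (L : (Y₁ → ℚ) →ₗ[ℚ] (Y₂ → ℚ)), L ∈ 𝓗 q ↔ (∀ f, L f ∈ N q) ∧
      ∀ (k : G) (f : Y₁ → ℚ), L (fun x => f (k • x)) = fun y => L f (k • y))
    (hNst : ∀ (q : σ) (k : G) (v : Y₂ → ℚ), v ∈ N q → (fun y => v (k • y)) ∈ N q)
    (hind : iSupIndep N) (htop : (⨆ q, N q) = ⊤) :
    Module.finrank ℚ 𝓗t = ∑ q, Module.finrank ℚ (𝓗 q) := by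
  have hproj := fun q => exists_equivariant_proj_of_iSupIndep (G := G) hNst hind htop q
  choose π hπmem hπid hπkill hπeq using hproj
  -- `Θ L = (π_q ∘ L)_q`
  let Θ : ((Y₁ → ℚ) →ₗ[ℚ] (Y₂ → ℚ)) →ₗ[ℚ] (σ → ((Y₁ → ℚ) →ₗ[ℚ] (Y₂ → ℚ))) :=
    LinearMap.pi fun q => LinearMap.llcomp ℚ (Y₁ → ℚ) (Y₂ → ℚ) (Y₂ → ℚ) (π q)
  have hΘ : ∀ L q, Θ L q = π q ∘ₗ L := fun L q => rfl
  have hmap : 𝓗t.map Θ = Submodule.pi Set.univ 𝓗 := by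
    refine le_antisymm ?_ fun Ls hLs => ?_
    · rintro _ ⟨L, hL, rfl⟩
      obtain ⟨-, hLeq⟩ := (h𝓗t L).1 hL
      exact fun q _ => (h𝓗 q _).2 ⟨fun f => hπmem q _, fun k f => by
        rw [hΘ, LinearMap.comp_apply, LinearMap.comp_apply, hLeq k f, hπeq q k]⟩
    · have hq : ∀ q, (∀ f, Ls q f ∈ N q) ∧
          ∀ (k : G) (f : Y₁ → ℚ), Ls q (fun x => f (k • x)) = fun y => Ls q f (k • y) :=
        fun q => (h𝓗 q _).1 (hLs q (Set.mem_univ q))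
      refine ⟨∑ q, Ls q, (h𝓗t _).2 ⟨fun _ => Submodule.mem_top, fun k f => ?_⟩, funext fun q => ?_⟩
      · rw [LinearMap.sum_apply, LinearMap.sum_apply]
        funext y
        rw [Finset.sum_apply, Finset.sum_apply]
        exact Finset.sum_congr rfl fun q _ => by rw [(hq q).2 k f]
      · rw [hΘ]
        refine LinearMap.ext fun f => ?_
        rw [LinearMap.comp_apply, LinearMap.sum_apply, map_sum,
          Finset.sum_eq_single q (fun q' _ hq' => hπkill q q' hq' _ ((hq q').1 f))
            (fun h => absurd (Finset.mem_univ q) h), hπid q _ ((hq q).1 f)]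
  have hinj : ∀ L ∈ 𝓗t, Θ L = 0 → L = 0 := by
    intro L _ hL0
    refine LinearMap.ext fun f => ?_
    rw [LinearMap.zero_apply, eq_sum_proj htop π hπid hπkill (L f)]
    refine Finset.sum_eq_zero fun q _ => ?_
    have h := congrFun hL0 q
    rw [hΘ] at h
    exact LinearMap.congr_fun h f
  rw [← finrank_map_eq_finrank_of_injOn Θ 𝓗t hinj, hmap, finrank_pi_eq_sum]

end Additive

/-! ### §3 Hom into an embedded copy of a reference -/

section Copy

variable {YA : Type vA} [MulAction G YA] {A : Submodule ℚ (YA → ℚ)}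
  {𝓗A : Submodule ℚ ((Y₁ → ℚ) →ₗ[ℚ] (YA → ℚ))} {𝓗N : Submodule ℚ ((Y₁ → ℚ) →ₗ[ℚ] (Y₂ → ℚ))}

/-- **`dim Hom_G(ℚ^{Y₁}, θ′(A)) = dim Hom_G(ℚ^{Y₁}, A)`** for `θ′ : ℚ^{Y_A} → ℚ^{Y₂}` injective and equivariant on
the stable `A`: `L′ ↦ θ′ ∘ L′` is injective on `Hom_G(ℚ^{Y₁}, A)` with image `Hom_G(ℚ^{Y₁}, θ′(A))` (preimages
`θ ∘ L` by the equivariant inverse `θ` of file R2). [cite: Serre1977, §2.2] [cite: CurtisReiner1962, §27 (27.3)] -/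
theorem finrank_homSpace_map_eq
    (h𝓗A : ∀ L : (Y₁ → ℚ) →ₗ[ℚ] (YA → ℚ), L ∈ 𝓗A ↔ (∀ f, L f ∈ A) ∧
      ∀ (k : G) (f : Y₁ → ℚ), L (fun x => f (k • x)) = fun y => L f (k • y))
    (θ' : (YA → ℚ) →ₗ[ℚ] (Y₂ → ℚ))
    (h𝓗N : ∀ L : (Y₁ → ℚ) →ₗ[ℚ] (Y₂ → ℚ), L ∈ 𝓗N ↔ (∀ f, L f ∈ A.map θ') ∧
      ∀ (k : G) (f : Y₁ → ℚ), L (fun x => f (k • x)) = fun y => L f (k • y))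
    (hAst : ∀ (k : G) (a : YA → ℚ), a ∈ A → (fun y => a (k • y)) ∈ A)
    (hinj : ∀ a ∈ A, θ' a = 0 → a = 0)
    (hθ'eq : ∀ (k : G) (a : YA → ℚ), a ∈ A → θ' (fun y => a (k • y)) = fun x => θ' a (k • x)) :
    Module.finrank ℚ 𝓗N = Module.finrank ℚ 𝓗A := by
  obtain ⟨θ, hθinv, hθmem, hθeq⟩ := exists_equivariant_inverse (G := G) hAst θ' hinj hθ'eq
  let Λ : ((Y₁ → ℚ) →ₗ[ℚ] (YA → ℚ)) →ₗ[ℚ] ((Y₁ → ℚ) →ₗ[ℚ] (Y₂ → ℚ)) :=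
    LinearMap.llcomp ℚ (Y₁ → ℚ) (YA → ℚ) (Y₂ → ℚ) θ'
  have hΛ : ∀ L, Λ L = θ' ∘ₗ L := fun L => rfl
  have hmap : 𝓗A.map Λ = 𝓗N := by
    refine le_antisymm ?_ fun L hL => ?_
    · rintro _ ⟨L', hL', rfl⟩
      obtain ⟨hL'A, hL'eq⟩ := (h𝓗A L').1 hL'
      refine (h𝓗N _).2 ⟨fun f => Submodule.mem_map_of_mem (hL'A f), fun k f => ?_⟩
      rw [hΛ, LinearMap.comp_apply, LinearMap.comp_apply, hL'eq k f, hθ'eq k _ (hL'A f)]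
    · obtain ⟨hLN, hLeq⟩ := (h𝓗N L).1 hL
      refine ⟨θ ∘ₗ L, (h𝓗A _).2 ⟨fun f => hθmem _ (hLN f), fun k f => ?_⟩, ?_⟩
      · rw [LinearMap.comp_apply, LinearMap.comp_apply, hLeq k f, hθeq k _ (hLN f)]
      · rw [hΛ]
        refine LinearMap.ext fun f => ?_
        obtain ⟨a, ha, hfa⟩ := Submodule.mem_map.1 (hLN f)
        rw [LinearMap.comp_apply, LinearMap.comp_apply, ← hfa, hθinv a ha]
  have hinjΛ : ∀ L' ∈ 𝓗A, Λ L' = 0 → L' = 0 := by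
    intro L' hL' h0
    obtain ⟨hL'A, -⟩ := (h𝓗A L').1 hL'
    refine LinearMap.ext fun f => ?_
    have h := LinearMap.congr_fun h0 f
    rw [hΛ, LinearMap.comp_apply, LinearMap.zero_apply] at h
    rw [LinearMap.zero_apply]
    exact hinj _ (hL'A f) h
  rw [← hmap, finrank_map_eq_finrank_of_injOn Λ 𝓗A hinjΛ]

end Copy

end Summit.HodgeConjecture.CorCM.IrrOdd

end
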